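import Literature.Analysis.FluidPDE.NavierStokesReynolds
import Literature.Analysis.FluidPDE.MixedNormSeries
import HarnessLib

/-!
# Limits of Cheskidov–Luo iterations of the Navier–Stokes–Reynolds system

A. Cheskidov, X. Luo, *Sharp nonuniqueness for the Navier–Stokes equations*, Invent. Math. 229
(2022) 987–1054 = arXiv:2009.06596 (numbering of the held arXiv copy), prove their main theorem
(Thm. 1.7 = the accepted named fact
`Literature.Barriers.NavierStokesRegularity.CheskidovLuo2022MainTheorem`) in §2.6 by iterating
the main proposition (Prop. 2.2 = the accepted named fact `Torus.CheskidovLuo2022MainIteration`)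
and passing to the limit. This file formalises the limit passage for an ABSTRACT sequence with the
properties the iteration delivers (`Torus.CheskidovLuoSequence`, a hypothesis structure: smooth
zero-mean Navier–Stokes–Reynolds solutions `(uₖ, pₖ, Rₖ)` on `[0, T]`, well-prepared for nested
closed sets `Iₖ ⊇ Iₖ₊₁ ∌ 0, T` with scales `τₖ₊₁ ≤ τₖ/2`, `uₖ₊₁ = uₖ` off `Iₖ` and at `t = 0`,
increments `≤ δₖ₊₁` in `L^p_t L^∞_x` with `∑ δₖ < ∞` and summable in `L²_{t,x}`, stresses `→ 0` in
`L¹_{t,x}`), and proves, [cite: CheskidovLuo2022, §2.6 (proof of Thm. 1.7)]: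

* the limit field `D.lim` (§2.6: "`u(t) ≡ uₙ(t)` on `𝓑ₙᶜ` for each `n`"): `D.lim t = uₖ t` for
  `t ∈ [0, T] ∖ Iₖ` (`lim_eq_of_not_mem`), with the junk value `u₀ t` on the residual set
  `⋂ₖ Iₖ` (of measure zero, `volume_residual`), so that every slice of the limit on `[0, T]` is
  a slice of some `uₖ` (smooth, divergence free, zero mean);
* the intervals of regularity: `D.lim` is jointly smooth on the open set
  `⋃ₖ (0, T) ∖ Iₖ ⊆ [0, T]` (`isSmoothSpaceTimeOn_lim_regularSet`) whose complement in `[0, T]`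
  has Hausdorff dimension `≤ ε` (`dimH_Icc_diff_regularSet_le`, from the accepted
  `dimH_le_of_finset_Icc_covers`: "each `𝓑ₙ` is covered by at most `τₙ^{-ε}` many balls of
  radius `5τₙ`");
* "`u` agrees with the unique smooth solution with initial data `v(0)` near `t = 0`": on some
  `[0, τ]`, `τ > 0`, the limit is `u₁`, a classical Navier–Stokes solution there
  (`exists_isClassicalNSSolutionOn_near_zero`);
* the mixed-norm estimates by countable Minkowski (`Literature.Analysis.FluidPDE.MixedNormSeries`):
  `‖lim - u₀‖_{L^p(0,T;L^∞)} ≤ ∑ₖ δₖ₊₁` (`eLqLpNorm_lim_sub_le`), `lim ∈ L^p(0,T;L^∞)`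
  (`memLqLp_lim`), and the square-integrable majorant `H(t) = ‖u₀(t)‖_{L²} + ∑ₖ ‖wₖ(t)‖_{L²}` of
  all `‖uₖ(t)‖_{L²}` and of `‖lim(t)‖_{L²}` (`lintegral_H_sq_lt_top`), which feeds the dominated
  convergence in the weak formulation (`Literature.Analysis.FluidPDE.NavierStokesReynoldsWeakLimit`).

## References

* A. Cheskidov, X. Luo, Invent. Math. 229 (2022) 987–1054; arXiv:2009.06596, §2.6. [`CheskidovLuo2022`]
-/

open MeasureTheory Set Filter
open scoped ENNReal NNReal InnerProductSpace _root_.Topology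

noncomputable section

namespace Literature.Analysis.FluidPDE

namespace Torus

variable {d : Type*} [Fintype d] [DecidableEq d]

/-! ## The hypothesis structure -/

/-- **A Cheskidov–Luo sequence on `[0, T]`** (the output of iterating Cheskidov–Luo 2022,
Prop. 2.2 = `Torus.CheskidovLuo2022MainIteration`, as in the proof of Thm. 1.7, §2.6, recorded
abstractly): smooth solutions `(uₖ, pₖ, Rₖ)` of the Navier–Stokes–Reynolds system (viscosity `1`)
on `[0, T] × 𝕋^d` with zero-mean velocities, well-prepared (Def. 2.1, exponent `ε ∈ [0, 1)`) for
sets `Iₖ` and scales `τₖ` with `Iₖ₊₁ ⊆ Iₖ`, `0, T ∉ Iₖ₊₁`, `τₖ₊₁ ≤ τₖ / 2`; the velocity is not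
changed off the current set nor at the initial time (`uₖ₊₁ = uₖ` on `[0, T] ∖ Iₖ` and at `t = 0`);
the increments `wₖ = uₖ₊₁ - uₖ` satisfy `‖wₖ‖_{L^p(0,T;L^∞)} ≤ δₖ₊₁` for a summable sequence of
sizes `δ ≥ 0` (print: `δₙ = 2⁻ⁿ ε`) and `∑ₖ ‖wₖ‖_{L²(0,T;L²)} < ∞` (print: `≤ ∑ M δₙ`), and the
stresses tend to zero in `L¹(0,T; L¹)` (print: `‖Rₙ‖_{L¹Lʳ} ≤ δₙ`). Everything §2.6 uses of
the iteration is a field. [cite: CheskidovLuo2022, §2.6 (proof of Thm. 1.7)] -/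
structure CheskidovLuoSequence (d : Type*) [Fintype d] [DecidableEq d] (T ε p : ℝ) where
  /-- The velocities `uₖ`. -/
  U : ℕ → ℝ → UnitAddTorus d → EuclideanSpace ℝ d
  /-- The pressures `pₖ`. -/
  P : ℕ → ℝ → UnitAddTorus d → ℝ
  /-- The Reynolds stresses `Rₖ` (stored by columns). -/
  R : ℕ → ℝ → UnitAddTorus d → d → EuclideanSpace ℝ d
  /-- The sets `Iₖ` of the well-prepared configurations. -/
  I : ℕ → Set ℝ
  /-- The length scales `τₖ`. -/
  τ : ℕ → ℝ
  /-- The sizes `δₖ` of the increments in `L^p_t L^∞_x`. -/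
  δ : ℕ → ℝ
  /-- `T > 0`. -/
  T_pos : 0 < T
  /-- `0 ≤ ε`. -/
  ε_nonneg : 0 ≤ ε
  /-- `ε < 1`. -/
  ε_lt_one : ε < 1
  /-- `1 ≤ p`. -/
  one_le_p : 1 ≤ p
  /-- `(uₖ, pₖ, Rₖ)` solves the Navier–Stokes–Reynolds system on `[0, T]`. -/
  nsr : ∀ k, IsNSReynoldsOn (Icc 0 T) 1 (U k) (P k) (R k)
  /-- The velocities have zero spatial mean. -/
  hasZeroMean : ∀ k, ∀ t ∈ Icc 0 T, FunctionSpaces.Torus.HasZeroMean (U k t)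
  /-- `(uₖ, Rₖ)` is well-prepared for `(Iₖ, τₖ)`. -/
  wellPrepared : ∀ k, IsWellPrepared T ε (R k) (I k) (τ k)
  /-- The sets are nested. -/
  I_succ_subset : ∀ k, I (k + 1) ⊆ I k
  /-- `0 ∉ Iₖ₊₁`. -/
  zero_not_mem : ∀ k, (0 : ℝ) ∉ I (k + 1)
  /-- `T ∉ Iₖ₊₁`. -/
  T_not_mem : ∀ k, T ∉ I (k + 1)
  /-- The scales at least halve. -/
  τ_succ_le : ∀ k, τ (k + 1) ≤ τ k / 2
  /-- `uₖ₊₁ = uₖ` at the times of `[0, T]` outside `Iₖ`. -/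
  U_succ_eq : ∀ k, ∀ t ∈ Icc 0 T, t ∉ I k → U (k + 1) t = U k t
  /-- `uₖ₊₁(0) = uₖ(0)`. -/
  U_succ_zero : ∀ k, U (k + 1) 0 = U k 0
  /-- The sizes are nonnegative. -/
  δ_nonneg : ∀ k, 0 ≤ δ k
  /-- The sizes are summable. -/
  summable_δ : Summable δ
  /-- `‖uₖ₊₁ - uₖ‖_{L^p(0,T;L^∞)} ≤ δₖ₊₁`. -/
  eLqLpNorm_sub_le : ∀ k, eLqLpNorm (ENNReal.ofReal p) ∞ (fun t x => U (k + 1) t x - U k t x) (Ioo 0 T) ≤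
    ENNReal.ofReal (δ (k + 1))
  /-- `∑ₖ ‖uₖ₊₁ - uₖ‖_{L²(0,T;L²)} < ∞`. -/
  tsum_eLqLpNorm_two_ne_top : ∑' k, eLqLpNorm 2 2 (fun t x => U (k + 1) t x - U k t x) (Ioo 0 T) ≠ ⊤
  /-- `‖Rₖ‖_{L¹(0,T;L¹)} → 0`. -/
  tendsto_eLqLpNorm_stress : Tendsto (fun k => eLqLpNorm 1 1 (R k) (Ioo 0 T)) atTop (𝓝 0)

namespace CheskidovLuoSequence

variable {T ε p : ℝ} (D : CheskidovLuoSequence d T ε p)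

/-! ## Stabilisation and the limit field -/

/-- The sets `Iₖ` decrease. [cite: CheskidovLuo2022, §2.6 (proof of Thm. 1.7)] -/
theorem I_antitone : Antitone D.I :=
  antitone_nat_of_succ_le D.I_succ_subset

/-- **Stabilisation**: off `Iₘ` the velocities no longer change, `uₖ(t) = uₘ(t)` for `k ≥ m` and
`t ∈ [0, T] ∖ Iₘ` (§2.6: "`w_k(t) ≡ 0` on `𝓑ₙᶜ` for all `k ≥ n`"). [cite: CheskidovLuo2022, §2.6 (proof of Thm. 1.7)] -/
theorem U_eq_of_not_mem {t : ℝ} (ht : t ∈ Icc 0 T) {m k : ℕ} (hmk : m ≤ k) (htm : t ∉ D.I m) :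
    D.U k t = D.U m t := by
  induction hmk with
  | refl => rfl
  | step hle ih => rw [D.U_succ_eq _ t ht (fun h => htm (D.I_antitone hle h)), ih]

/-- The initial slice never changes: `uₖ(0) = u₀(0)`. [cite: CheskidovLuo2022, §2.6 (proof of Thm. 1.7)] -/
theorem U_zero_eq (k : ℕ) : D.U k 0 = D.U 0 0 := by
  induction k with
  | zero => rfl
  | succ k ih => rw [D.U_succ_zero, ih]

/-- The residual (singular) set of times `𝓢 = ⋂ₖ Iₖ` (§2.6: "`(0,1) ∖ 𝓘 = ⋂ₙ 𝓑ₙ`"). [cite: CheskidovLuo2022, §2.6 (proof of Thm. 1.7)] -/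
def residual : Set ℝ :=
  ⋂ k, D.I k

open Classical in
/-- **The limit field** `u = lim uₖ`: at a time `t` lying outside some `Iₖ` it is the common
value `uₖ(t)` of all later velocities (§2.6: "hence `u(t) ≡ uₙ(t)` on `𝓑ₙᶜ` for each `n`"); on
the residual set `⋂ₖ Iₖ` (of measure zero) it is given the junk value `u₀(t)`. [cite: CheskidovLuo2022, §2.6 (proof of Thm. 1.7)] -/
def lim : ℝ → UnitAddTorus d → EuclideanSpace ℝ d := fun t =>
  if h : ∃ k, t ∉ D.I k then D.U (Nat.find h) t else D.U 0 t

/-- Off `Iₖ` (within `[0, T]`) the limit is `uₖ`. [cite: CheskidovLuo2022, §2.6 (proof of Thm. 1.7)] -/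
theorem lim_eq_of_not_mem {t : ℝ} (ht : t ∈ Icc 0 T) {k : ℕ} (htk : t ∉ D.I k) :
    D.lim t = D.U k t := by
  classical
  have h : ∃ k, t ∉ D.I k := ⟨k, htk⟩
  rw [lim, dif_pos h]
  exact (D.U_eq_of_not_mem ht (Nat.find_min' h htk) (Nat.find_spec h)).symm

/-- On the residual set the limit takes the junk value `u₀`. [cite: CheskidovLuo2022, §2.6 (proof of Thm. 1.7)] -/
theorem lim_eq_of_forall_mem {t : ℝ} (h : ∀ k, t ∈ D.I k) : D.lim t = D.U 0 t := by
  classical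
  rw [lim, dif_neg fun ⟨k, hk⟩ => hk (h k)]

/-- Every slice of the limit is a slice of some `uₖ`. [cite: CheskidovLuo2022, §2.6 (proof of Thm. 1.7)] -/
theorem exists_lim_eq (t : ℝ) : ∃ k, D.lim t = D.U k t := by
  classical
  by_cases h : ∃ k, t ∉ D.I k
  · exact ⟨Nat.find h, by rw [lim, dif_pos h]⟩
  · exact ⟨0, by rw [lim, dif_neg h]⟩

/-- The limit has the common initial slice `u₀(0)` (`0 ∉ I₁`). [cite: CheskidovLuo2022, §2.6 (proof of Thm. 1.7)] -/
theorem lim_zero : D.lim 0 = D.U 0 0 := by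
  rw [D.lim_eq_of_not_mem ⟨le_rfl, D.T_pos.le⟩ (D.zero_not_mem 0), D.U_zero_eq]

/-- Slices of the limit on `[0, T]` are smooth. [cite: CheskidovLuo2022, §2.6 (proof of Thm. 1.7)] -/
theorem isSmooth_lim {t : ℝ} (ht : t ∈ Icc 0 T) : FunctionSpaces.Torus.IsSmooth (D.lim t) := by
  obtain ⟨k, hk⟩ := D.exists_lim_eq t
  rw [hk]
  exact (D.nsr k).smooth_velocity.isSmooth_slice ht

/-- Slices of the limit on `[0, T]` are divergence free. [cite: CheskidovLuo2022, §2.6 (proof of Thm. 1.7)] -/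
theorem isDivFree_lim {t : ℝ} (ht : t ∈ Icc 0 T) : FunctionSpaces.Torus.IsDivFree (D.lim t) := by
  obtain ⟨k, hk⟩ := D.exists_lim_eq t
  rw [hk]
  exact (D.nsr k).divFree t ht

/-- Slices of the limit on `[0, T]` have zero mean. [cite: CheskidovLuo2022, §2.6 (proof of Thm. 1.7)] -/
theorem hasZeroMean_lim {t : ℝ} (ht : t ∈ Icc 0 T) : FunctionSpaces.Torus.HasZeroMean (D.lim t) := by
  obtain ⟨k, hk⟩ := D.exists_lim_eq t
  rw [hk]
  exact D.hasZeroMean k t ht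

/-- Off the residual set the velocities are eventually equal to the limit. [cite: CheskidovLuo2022, §2.6 (proof of Thm. 1.7)] -/
theorem eventually_U_eq_lim {t : ℝ} (ht : t ∈ Icc 0 T) (hres : t ∉ D.residual) :
    ∀ᶠ k in atTop, D.U k t = D.lim t := by
  obtain ⟨m, hm⟩ : ∃ m, t ∉ D.I m := by
    simpa [residual, mem_iInter] using hres
  filter_upwards [eventually_ge_atTop m] with k hk
  rw [D.U_eq_of_not_mem ht hk hm, D.lim_eq_of_not_mem ht hm]

/-! ## The scales, the measure of the residual set and its Hausdorff dimension -/

/-- The scales are positive. [cite: CheskidovLuo2022, Def. 2.1] -/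
theorem τ_pos (k : ℕ) : 0 < D.τ k :=
  (D.wellPrepared k).pos

/-- The scales decay geometrically, `τₖ ≤ τ₀ 2⁻ᵏ`. [cite: CheskidovLuo2022, §2.6 (proof of Thm. 1.7)] -/
theorem τ_le (k : ℕ) : D.τ k ≤ D.τ 0 / 2 ^ k := by
  induction k with
  | zero => simp
  | succ k ih =>
    calc D.τ (k + 1) ≤ D.τ k / 2 := D.τ_succ_le k
      _ ≤ D.τ 0 / 2 ^ k / 2 := by gcongr
      _ = D.τ 0 / 2 ^ (k + 1) := by rw [pow_succ, div_div]

/-- The scales tend to zero. [cite: CheskidovLuo2022, §2.6 (proof of Thm. 1.7)] -/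
theorem tendsto_τ : Tendsto D.τ atTop (𝓝 0) := by
  have h : Tendsto (fun k => D.τ 0 / 2 ^ k) atTop (𝓝 0) := by
    have h1 : Tendsto (fun k : ℕ => ((1 : ℝ) / 2) ^ k) atTop (𝓝 0) :=
      tendsto_pow_atTop_nhds_zero_of_lt_one (by norm_num) (by norm_num)
    have h2 := h1.const_mul (D.τ 0)
    simp only [mul_zero] at h2
    refine h2.congr fun k => ?_
    rw [one_div, inv_pow, div_eq_mul_inv]
  exact tendsto_of_tendsto_of_tendsto_of_le_of_le tendsto_const_nhds h
    (fun k => (D.τ_pos k).le) fun k => D.τ_le k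

/-- The sets `Iₖ` have measure at most `5 T^ε τₖ^{1-ε}` (at most `(T/τₖ)^ε` intervals of length
`5τₖ`). [cite: CheskidovLuo2022, §2.6 (proof of Thm. 1.7)] -/
theorem volume_I_le (k : ℕ) :
    volume (D.I k) ≤ ENNReal.ofReal ((T / D.τ k) ^ ε * (5 * D.τ k)) := by
  obtain ⟨s, hs, hI⟩ := (D.wellPrepared k).exists_finset
  have hτ := D.τ_pos k
  rw [hI]
  calc volume (⋃ a ∈ s, Icc a (a + 5 * D.τ k))
      ≤ ∑ a ∈ s, volume (Icc a (a + 5 * D.τ k)) := measure_biUnion_finset_le _ _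
    _ = ∑ _a ∈ s, ENNReal.ofReal (5 * D.τ k) := Finset.sum_congr rfl fun a _ => by
        rw [Real.volume_Icc, add_sub_cancel_left]
    _ = ENNReal.ofReal (s.card * (5 * D.τ k)) := by
        rw [Finset.sum_const, nsmul_eq_mul, ENNReal.ofReal_mul (Nat.cast_nonneg _),
          ENNReal.ofReal_natCast]
    _ ≤ ENNReal.ofReal ((T / D.τ k) ^ ε * (5 * D.τ k)) := by
        gcongr

/-- **The residual set has measure zero** (`5 T^ε τₖ^{1-ε} → 0` since `ε < 1`; §2.6: "the
Lebesgue measure of the singular set in time is zero"). [cite: CheskidovLuo2022, §2.6 (proof of Thm. 1.7)] -/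
theorem volume_residual : volume D.residual = 0 := by
  have hle : ∀ k, volume D.residual ≤ ENNReal.ofReal ((T / D.τ k) ^ ε * (5 * D.τ k)) := fun k =>
    (measure_mono (iInter_subset _ k)).trans (D.volume_I_le k)
  -- rewrite the bound as `5 T^ε τₖ^{1-ε}` and let `k → ∞`
  have heq : ∀ k, (T / D.τ k) ^ ε * (5 * D.τ k) = 5 * T ^ ε * D.τ k ^ (1 - ε) := by
    intro k
    have hτ := D.τ_pos k
    rw [Real.div_rpow D.T_pos.le hτ.le, Real.rpow_sub hτ, Real.rpow_one]
    field_simp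
  have hlim : Tendsto (fun k => ENNReal.ofReal ((T / D.τ k) ^ ε * (5 * D.τ k))) atTop (𝓝 0) := by
    simp_rw [heq]
    rw [← ENNReal.ofReal_zero]
    refine ENNReal.tendsto_ofReal ?_
    have h0 : Tendsto (fun k => D.τ k ^ (1 - ε)) atTop (𝓝 0) := by
      have := D.tendsto_τ.rpow_const (p := 1 - ε) (Or.inr (by linarith [D.ε_lt_one]))
      rwa [Real.zero_rpow (by linarith [D.ε_lt_one])] at this
    simpa using h0.const_mul (5 * T ^ ε)
  exact le_antisymm (ge_of_tendsto' hlim hle) bot_le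

/-- **The residual set has Hausdorff dimension `≤ ε`** (§2.6: "Since each `𝓑ₙ` is covered by at
most `τₙ^{-ε}` many balls of radius `5τₙ`, we have `d_𝓗(limsup 𝓑ₙ) ≤ ε`"; here via the accepted
`dimH_le_of_finset_Icc_covers`). [cite: CheskidovLuo2022, §2.6 (proof of Thm. 1.7)] -/
theorem dimH_residual_le : dimH D.residual ≤ ENNReal.ofReal ε := by
  choose s hs hI using fun k => (D.wellPrepared k).exists_finset
  refine dimH_le_of_finset_Icc_covers D.ε_nonneg (fun k => 5 * D.τ k)
    (fun k => by linarith [D.τ_pos k]) ?_ s (A := (5 * T) ^ ε) (fun k => ?_) fun k => ?_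
  · simpa using D.tendsto_τ.const_mul 5
  · have hτ := D.τ_pos k
    calc ((s k).card : ℝ) ≤ (T / D.τ k) ^ ε := hs k
      _ = (5 * T) ^ ε * (5 * D.τ k) ^ (-ε) := by
          rw [Real.rpow_neg (by positivity), ← div_eq_mul_inv,
            ← Real.div_rpow (by linarith [D.T_pos]) (by positivity),
            mul_div_mul_left _ _ (by norm_num : (5 : ℝ) ≠ 0)]
  · rw [← hI k]
    exact iInter_subset _ k

/-! ## The intervals of regularity -/

/-- The open set of regular times, `𝓘 = ⋃ₖ (0, T) ∖ Iₖ` (§2.6: "`𝓘 = ⋃ₙ 𝓑ₙᶜ ∖ {0,1}`"). [cite: CheskidovLuo2022, §2.6 (proof of Thm. 1.7)] -/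
def regularSet : Set ℝ :=
  ⋃ k, Ioo 0 T \ D.I k

/-- The set of regular times is open (the `Iₖ` are closed). [cite: CheskidovLuo2022, §2.6 (proof of Thm. 1.7)] -/
theorem isOpen_regularSet : IsOpen D.regularSet :=
  isOpen_iUnion fun k => isOpen_Ioo.sdiff (D.wellPrepared k).isClosed

/-- The regular times lie in `[0, T]`. [cite: CheskidovLuo2022, §2.6 (proof of Thm. 1.7)] -/
theorem regularSet_subset : D.regularSet ⊆ Icc 0 T :=
  iUnion_subset fun _ => (fun _ ht => Ioo_subset_Icc_self ht.1)

/-- The non-regular times of `[0, T]` are the endpoints and the residual set. [cite: CheskidovLuo2022, §2.6 (proof of Thm. 1.7)] -/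
theorem Icc_diff_regularSet_subset : Icc 0 T \ D.regularSet ⊆ {0, T} ∪ D.residual := by
  rintro t ⟨ht, hreg⟩
  by_cases h0 : t = 0
  · exact Or.inl (Or.inl h0)
  by_cases hT : t = T
  · exact Or.inl (Or.inr hT)
  refine Or.inr (mem_iInter.2 fun k => by_contra fun hk => hreg (mem_iUnion.2 ⟨k, ?_, hk⟩))
  exact ⟨lt_of_le_of_ne ht.1 (Ne.symm h0), lt_of_le_of_ne ht.2 hT⟩

/-- **The non-regular times of `[0, T]` have Hausdorff dimension `≤ ε`.** [cite: CheskidovLuo2022, §2.6 (proof of Thm. 1.7)] -/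
theorem dimH_Icc_diff_regularSet_le : dimH (Icc 0 T \ D.regularSet) ≤ ENNReal.ofReal ε := by
  refine (dimH_mono D.Icc_diff_regularSet_subset).trans ?_
  rw [dimH_union, dimH_countable ((Set.toFinite _).countable)]
  exact max_le bot_le D.dimH_residual_le

/-- **The limit is jointly smooth on the regular times** (`u = uₖ` on the open set
`((0,T) ∖ Iₖ) × 𝕋^d`, and `uₖ` is smooth; §2.6: "this proves that
`u|_{𝓘 × 𝕋^d} ∈ C^∞(𝓘 × 𝕋^d)`"). [cite: CheskidovLuo2022, §2.6 (proof of Thm. 1.7)] -/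
theorem isSmoothSpaceTimeOn_lim_regularSet :
    FunctionSpaces.Torus.IsSmoothSpaceTimeOn D.regularSet D.lim := by
  refine contDiffOn_of_locally_contDiffOn fun z hz => ?_
  obtain ⟨t, y⟩ := z
  have ht : t ∈ D.regularSet := (mem_prod.1 hz).1
  obtain ⟨k, hk⟩ := mem_iUnion.1 ht
  refine ⟨(Ioo 0 T \ D.I k) ×ˢ univ, (isOpen_Ioo.sdiff (D.wellPrepared k).isClosed).prod isOpen_univ,
    mk_mem_prod hk (mem_univ _), ?_⟩
  have hsm : FunctionSpaces.Torus.IsSmoothSpaceTimeOn (Ioo 0 T \ D.I k) (D.U k) :=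
    (D.nsr k).smooth_velocity.mono fun _ hs => Ioo_subset_Icc_self hs.1
  refine (ContDiffOn.congr hsm fun z hz => ?_).mono inter_subset_right
  obtain ⟨s, y'⟩ := z
  have hs : s ∈ Ioo 0 T \ D.I k := (mem_prod.1 hz).1
  simp only [FunctionSpaces.Torus.stLift_apply]
  rw [D.lim_eq_of_not_mem (Ioo_subset_Icc_self hs.1) hs.2]

/-- **Near `t = 0` the limit is the classical solution `u₁`**: there is `τ ∈ (0, T]` with
`[0, τ] ∩ I₁ = ∅`, so that on `[0, τ]` the stress `R₁` vanishes, `(u₁, p₁)` is a classical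
solution of the unforced Navier–Stokes system (accepted `Torus.IsClassicalNSSolutionOn`), and the
limit equals `u₁` (§2.6: "each `uₙ` also agrees with each other for `0 ≤ t ≤ τ₁/2`, and hence `u`
agree with the unique smooth solution with initial data `v(0)` near `t = 0`"). [cite: CheskidovLuo2022, §2.6 (proof of Thm. 1.7)] -/
theorem exists_isClassicalNSSolutionOn_near_zero :
    ∃ τ₁ : ℝ, 0 < τ₁ ∧ τ₁ ≤ T ∧
      FunctionSpaces.Torus.IsClassicalNSSolutionOn (Icc 0 τ₁) 1 0 (D.U 1) (D.P 1) ∧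
      D.U 1 0 = D.U 0 0 ∧ ∀ t ∈ Icc 0 τ₁, D.lim t = D.U 1 t := by
  have hopen : IsOpen (D.I 1)ᶜ := (D.wellPrepared 1).isClosed.isOpen_compl
  obtain ⟨η, hη, hball⟩ := Metric.isOpen_iff.1 hopen 0 (D.zero_not_mem 0)
  set τ₁ : ℝ := min (η / 2) T with hτ₁
  have hτ₁pos : 0 < τ₁ := lt_min (half_pos hη) D.T_pos
  have hτ₁T : τ₁ ≤ T := min_le_right _ _
  have hnot : ∀ t ∈ Icc 0 τ₁, t ∉ D.I 1 := by
    intro t ht hmem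
    refine hball ?_ hmem
    rw [Metric.mem_ball, Real.dist_eq, sub_zero, abs_of_nonneg ht.1]
    exact lt_of_le_of_lt (ht.2.trans (min_le_left _ _)) (half_lt_self hη)
  have hsub : Icc 0 τ₁ ⊆ Icc 0 T := Icc_subset_Icc_right hτ₁T
  refine ⟨τ₁, hτ₁pos, hτ₁T, ?_, D.U_succ_zero 0, fun t ht => D.lim_eq_of_not_mem (hsub ht) (hnot t ht)⟩
  exact (D.nsr 1).isClassicalNSSolutionOn_of_stress_eq_zero hsub (uniqueDiffOn_Icc hτ₁pos)
    fun t ht x => (D.wellPrepared 1).stress_eq_zero_of_not_mem (hsub ht) (hnot t ht) x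


/-! ## Telescoping and the mixed-norm estimates -/

/-- The increments `wₖ = uₖ₊₁ - uₖ`. [cite: CheskidovLuo2022, §2.6 (proof of Thm. 1.7)] -/
def w (k : ℕ) : ℝ → UnitAddTorus d → EuclideanSpace ℝ d :=
  fun t x => D.U (k + 1) t x - D.U k t x

/-- The increments are jointly smooth on `[0, T] × 𝕋^d`. [cite: CheskidovLuo2022, §2.6 (proof of Thm. 1.7)] -/
theorem isSmoothSpaceTimeOn_w (k : ℕ) : FunctionSpaces.Torus.IsSmoothSpaceTimeOn (Icc 0 T) (D.w k) :=
  (D.nsr (k + 1)).smooth_velocity.sub (D.nsr k).smooth_velocity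

/-- Telescoping: `uₖ(t) - u₀(t) = ∑_{j<k} wⱼ(t)`. [cite: CheskidovLuo2022, §2.6 (proof of Thm. 1.7)] -/
theorem U_sub_U_zero_eq_sum (k : ℕ) (t : ℝ) :
    (fun x => D.U k t x - D.U 0 t x) = ∑ j ∈ Finset.range k, D.w j t := by
  funext x
  rw [Finset.sum_apply]
  exact (Finset.sum_range_sub (fun j => D.U j t x) k).symm

/-- Minkowski along the telescoping sum: `‖uₖ(t) - u₀(t)‖_{L^q} ≤ ∑ⱼ ‖wⱼ(t)‖_{L^q}`, `q ≥ 1`. [cite: CheskidovLuo2022, §2.6 (proof of Thm. 1.7)] -/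
theorem eLpNorm_U_sub_U_zero_le {t : ℝ} (ht : t ∈ Icc 0 T) (k : ℕ) {q : ℝ≥0∞} (hq : 1 ≤ q) :
    eLpNorm (fun x => D.U k t x - D.U 0 t x) q volume ≤ ∑' j, eLpNorm (D.w j t) q volume := by
  rw [D.U_sub_U_zero_eq_sum k t]
  refine (eLpNorm_sum_le (fun j _ =>
    ((D.isSmoothSpaceTimeOn_w j).isSmooth_slice ht).continuous.aestronglyMeasurable) hq).trans ?_
  exact ENNReal.sum_le_tsum _

/-- `‖u(t) - u₀(t)‖_{L^q} ≤ ∑ⱼ ‖wⱼ(t)‖_{L^q}` for the limit, at every `t ∈ [0, T]`. [cite: CheskidovLuo2022, §2.6 (proof of Thm. 1.7)] -/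
theorem eLpNorm_lim_sub_U_zero_le {t : ℝ} (ht : t ∈ Icc 0 T) {q : ℝ≥0∞} (hq : 1 ≤ q) :
    eLpNorm (fun x => D.lim t x - D.U 0 t x) q volume ≤ ∑' j, eLpNorm (D.w j t) q volume := by
  obtain ⟨k, hk⟩ := D.exists_lim_eq t
  rw [hk]
  exact D.eLpNorm_U_sub_U_zero_le ht k hq

/-- The series of slice norms `Φ_q(t) = ∑ⱼ ‖wⱼ(t)‖_{L^q(𝕋^d)} ∈ [0, ∞]`. [cite: CheskidovLuo2022, §2.6 (proof of Thm. 1.7)] -/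
def sliceSeries (q : ℝ≥0∞) (t : ℝ) : ℝ≥0∞ :=
  ∑' j, eLpNorm (D.w j t) q volume

/-- The series of slice norms is a.e. measurable on `(0, T)`. [cite: CheskidovLuo2022, §2.6 (proof of Thm. 1.7)] -/
theorem aemeasurable_sliceSeries {q : ℝ≥0∞} (hq : 1 ≤ q) :
    AEMeasurable (D.sliceSeries q) (volume.restrict (Ioo 0 T)) :=
  AEMeasurable.tsum fun j => (D.isSmoothSpaceTimeOn_w j).aemeasurable_eLpNorm_slice hq

/-- **Countable Minkowski for the series of slice norms**:
`‖Φ_q‖_{L^r(0,T)} ≤ ∑ⱼ ‖wⱼ‖_{L^r(0,T;L^q)}` for `q, r ≥ 1` (§2.6: "`‖u - v‖ ≤ ∑ₙ ‖wₙ‖`").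
[cite: CheskidovLuo2022, §2.6 (proof of Thm. 1.7)] -/
theorem lintegral_sliceSeries_rpow_le {q : ℝ≥0∞} (hq : 1 ≤ q) {r : ℝ} (hr : 1 ≤ r) :
    (∫⁻ t in Ioo 0 T, D.sliceSeries q t ^ r) ^ (1 / r) ≤
      ∑' j, eLqLpNorm (ENNReal.ofReal r) q (D.w j) (Ioo 0 T) := by
  have h := lintegral_rpow_tsum_le (μ := volume.restrict (Ioo 0 T)) hr
    (fun j t => eLpNorm (D.w j t) q volume)
    fun j => (D.isSmoothSpaceTimeOn_w j).aemeasurable_eLpNorm_slice hq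
  refine h.trans (le_of_eq (tsum_congr fun j => ?_))
  rw [eLqLpNorm_eq_lintegral_rpow_of_smooth (D.isSmoothSpaceTimeOn_w j) (lt_of_lt_of_le zero_lt_one hr)]

/-- The shifted sizes are summable. [cite: CheskidovLuo2022, §2.6 (proof of Thm. 1.7)] -/
theorem summable_δ_succ : Summable fun j => D.δ (j + 1) :=
  (summable_nat_add_iff 1).2 D.summable_δ

/-- `∑ⱼ ‖wⱼ‖_{L^p(0,T;L^∞)} ≤ ∑ⱼ δⱼ₊₁`. [cite: CheskidovLuo2022, §2.6 (proof of Thm. 1.7)] -/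
theorem tsum_eLqLpNorm_w_le :
    ∑' j, eLqLpNorm (ENNReal.ofReal p) ∞ (D.w j) (Ioo 0 T) ≤ ENNReal.ofReal (∑' j, D.δ (j + 1)) := by
  rw [ENNReal.ofReal_tsum_of_nonneg (fun j => D.δ_nonneg _) D.summable_δ_succ]
  exact ENNReal.tsum_le_tsum fun j => D.eLqLpNorm_sub_le j

/-- `‖Φ_∞‖_{L^p(0,T)} ≤ ∑ⱼ δⱼ₊₁`. [cite: CheskidovLuo2022, §2.6 (proof of Thm. 1.7)] -/
theorem lintegral_sliceSeries_top_le :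
    (∫⁻ t in Ioo 0 T, D.sliceSeries ∞ t ^ p) ^ (1 / p) ≤ ENNReal.ofReal (∑' j, D.δ (j + 1)) :=
  (D.lintegral_sliceSeries_rpow_le le_top D.one_le_p).trans D.tsum_eLqLpNorm_w_le

/-- **The `L^p_t L^∞_x` estimate of the limit**: `‖u - u₀‖_{L^p(0,T;L^∞)} ≤ ∑ⱼ δⱼ₊₁` (§2.6:
"`‖u - v‖_{L^p_t L^∞} ≤ ∑ₙ ‖wₙ‖_{L^p_t L^∞} ≤ ∑ₙ 2⁻ⁿ ε ≤ ε`"). [cite: CheskidovLuo2022, §2.6 (proof of Thm. 1.7)] -/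
theorem eLqLpNorm_lim_sub_le :
    eLqLpNorm (ENNReal.ofReal p) ∞ (fun t x => D.lim t x - D.U 0 t x) (Ioo 0 T) ≤
      ENNReal.ofReal (∑' j, D.δ (j + 1)) :=
  (eLqLpNorm_le_lintegral_rpow measurableSet_Ioo (lt_of_lt_of_le zero_lt_one D.one_le_p) ∞
    (B := D.sliceSeries ∞) fun _ ht => D.eLpNorm_lim_sub_U_zero_le (Ioo_subset_Icc_self ht) le_top).trans
    D.lintegral_sliceSeries_top_le

/-- **The limit lies in `L^p(0,T; L^∞(𝕋^d))`** (accepted `Torus.MemLqLp`; the slices are smooth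
and `‖u(t)‖_{L^∞} ≤ sup ‖u₀‖ + Φ_∞(t)` with `Φ_∞ ∈ L^p(0,T)`). [cite: CheskidovLuo2022, §2.6 (proof of Thm. 1.7)] -/
theorem memLqLp_lim : MemLqLp (ENNReal.ofReal p) ∞ D.lim (Ioo 0 T) := by
  refine ⟨ae_restrict_of_forall_mem measurableSet_Ioo fun t ht =>
    (D.isSmooth_lim (Ioo_subset_Icc_self ht)).memLp ∞, ?_⟩
  obtain ⟨C, hC⟩ := (D.nsr 0).smooth_velocity.exists_norm_le_of_isCompact isCompact_Icc subset_rfl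
  have hp0 : 0 < p := lt_of_lt_of_le zero_lt_one D.one_le_p
  have hB : ∀ t ∈ Ioo 0 T, eLpNorm (D.lim t) ∞ volume ≤ ENNReal.ofReal C + D.sliceSeries ∞ t := by
    intro t ht
    have htI : t ∈ Icc 0 T := Ioo_subset_Icc_self ht
    have hm0 : AEStronglyMeasurable (D.U 0 t) volume :=
      ((D.nsr 0).smooth_velocity.isSmooth_slice htI).continuous.aestronglyMeasurable
    have hm1 : AEStronglyMeasurable (fun x => D.lim t x - D.U 0 t x) volume :=
      ((D.isSmooth_lim htI).continuous.sub
        ((D.nsr 0).smooth_velocity.isSmooth_slice htI).continuous).aestronglyMeasurable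
    calc eLpNorm (D.lim t) ∞ volume
        = eLpNorm ((D.U 0 t) + fun x => D.lim t x - D.U 0 t x) ∞ volume := by
          congr 1; funext x; simp
      _ ≤ eLpNorm (D.U 0 t) ∞ volume + eLpNorm (fun x => D.lim t x - D.U 0 t x) ∞ volume :=
          eLpNorm_add_le hm0 hm1 le_top
      _ ≤ ENNReal.ofReal C + D.sliceSeries ∞ t :=
          add_le_add (eLpNorm_le_of_forall_norm_le (hC t htI) ∞)
            (D.eLpNorm_lim_sub_U_zero_le htI le_top)
  have hconst : (∫⁻ _ in Ioo 0 T, ENNReal.ofReal C ^ p) ^ (1 / p) < ⊤ := by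
    rw [setLIntegral_const]
    refine ENNReal.rpow_lt_top_of_nonneg (by positivity) (ENNReal.mul_ne_top ?_ ?_)
    · exact ENNReal.rpow_ne_top_of_nonneg hp0.le ENNReal.ofReal_ne_top
    · rw [Real.volume_Ioo]; exact ENNReal.ofReal_ne_top
  calc eLqLpNorm (ENNReal.ofReal p) ∞ D.lim (Ioo 0 T)
      ≤ (∫⁻ t in Ioo 0 T, (ENNReal.ofReal C + D.sliceSeries ∞ t) ^ p) ^ (1 / p) :=
        eLqLpNorm_le_lintegral_rpow measurableSet_Ioo hp0 ∞ hB
    _ ≤ (∫⁻ _ in Ioo 0 T, ENNReal.ofReal C ^ p) ^ (1 / p) +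
          (∫⁻ t in Ioo 0 T, D.sliceSeries ∞ t ^ p) ^ (1 / p) :=
        ENNReal.lintegral_Lp_add_le aemeasurable_const (D.aemeasurable_sliceSeries le_top) D.one_le_p
    _ < ⊤ := ENNReal.add_lt_top.2 ⟨hconst,
        lt_of_le_of_lt D.lintegral_sliceSeries_top_le ENNReal.ofReal_lt_top⟩

/-! ## The square-integrable majorant -/

/-- The majorant `H(t) = ‖u₀(t)‖_{L²} + ∑ⱼ ‖wⱼ(t)‖_{L²} ∈ [0, ∞]` of all the slice `L²` norms
`‖uₖ(t)‖_{L²}`, `‖u(t)‖_{L²}`. [cite: CheskidovLuo2022, §2.6 (proof of Thm. 1.7)] -/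
def H (t : ℝ) : ℝ≥0∞ :=
  eLpNorm (D.U 0 t) 2 volume + D.sliceSeries 2 t

/-- The majorant is a.e. measurable on `(0, T)`. [cite: CheskidovLuo2022, §2.6 (proof of Thm. 1.7)] -/
theorem aemeasurable_H : AEMeasurable D.H (volume.restrict (Ioo 0 T)) :=
  ((D.nsr 0).smooth_velocity.aemeasurable_eLpNorm_slice one_le_two).add
    (D.aemeasurable_sliceSeries one_le_two)

/-- `‖uₖ(t)‖_{L²} ≤ H(t)` on `[0, T]`. [cite: CheskidovLuo2022, §2.6 (proof of Thm. 1.7)] -/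
theorem eLpNorm_U_le_H {t : ℝ} (ht : t ∈ Icc 0 T) (k : ℕ) : eLpNorm (D.U k t) 2 volume ≤ D.H t := by
  have hm0 : AEStronglyMeasurable (D.U 0 t) volume :=
    ((D.nsr 0).smooth_velocity.isSmooth_slice ht).continuous.aestronglyMeasurable
  have hm1 : AEStronglyMeasurable (fun x => D.U k t x - D.U 0 t x) volume :=
    (((D.nsr k).smooth_velocity.isSmooth_slice ht).continuous.sub
      ((D.nsr 0).smooth_velocity.isSmooth_slice ht).continuous).aestronglyMeasurable
  calc eLpNorm (D.U k t) 2 volume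
      = eLpNorm ((D.U 0 t) + fun x => D.U k t x - D.U 0 t x) 2 volume := by
        congr 1; funext x; simp
    _ ≤ eLpNorm (D.U 0 t) 2 volume + eLpNorm (fun x => D.U k t x - D.U 0 t x) 2 volume :=
        eLpNorm_add_le hm0 hm1 one_le_two
    _ ≤ D.H t := add_le_add le_rfl (D.eLpNorm_U_sub_U_zero_le ht k one_le_two)

/-- `‖u(t)‖_{L²} ≤ H(t)` on `[0, T]`. [cite: CheskidovLuo2022, §2.6 (proof of Thm. 1.7)] -/
theorem eLpNorm_lim_le_H {t : ℝ} (ht : t ∈ Icc 0 T) : eLpNorm (D.lim t) 2 volume ≤ D.H t := by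
  obtain ⟨k, hk⟩ := D.exists_lim_eq t
  rw [hk]
  exact D.eLpNorm_U_le_H ht k

/-- **The majorant is square integrable on `(0, T)`**:
`‖H‖_{L²(0,T)} ≤ ‖u₀‖_{L²(0,T;L²)} + ∑ⱼ ‖wⱼ‖_{L²(0,T;L²)} < ∞` (§2.6: "`uₙ` is Cauchy in
`L²_{t,x}`"). [cite: CheskidovLuo2022, §2.6 (proof of Thm. 1.7)] -/
theorem lintegral_H_sq_lt_top : ∫⁻ t in Ioo 0 T, D.H t ^ (2 : ℝ) < ⊤ := by
  have h1 : (∫⁻ t in Ioo 0 T, D.H t ^ (2 : ℝ)) ^ (1 / (2 : ℝ)) ≤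
      (∫⁻ t in Ioo 0 T, eLpNorm (D.U 0 t) 2 volume ^ (2 : ℝ)) ^ (1 / (2 : ℝ)) +
        (∫⁻ t in Ioo 0 T, D.sliceSeries 2 t ^ (2 : ℝ)) ^ (1 / (2 : ℝ)) :=
    ENNReal.lintegral_Lp_add_le ((D.nsr 0).smooth_velocity.aemeasurable_eLpNorm_slice one_le_two)
      (D.aemeasurable_sliceSeries one_le_two) one_le_two
  have h2 : (∫⁻ t in Ioo 0 T, eLpNorm (D.U 0 t) 2 volume ^ (2 : ℝ)) ^ (1 / (2 : ℝ)) < ⊤ := by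
    rw [← eLqLpNorm_eq_lintegral_rpow_of_smooth (D.nsr 0).smooth_velocity two_pos 2]
    exact (D.nsr 0).smooth_velocity.eLqLpNorm_lt_top (by simp) 2
  have h3 : (∫⁻ t in Ioo 0 T, D.sliceSeries 2 t ^ (2 : ℝ)) ^ (1 / (2 : ℝ)) < ⊤ := by
    refine lt_of_le_of_lt (D.lintegral_sliceSeries_rpow_le one_le_two one_le_two) ?_
    rw [ENNReal.ofReal_ofNat]
    exact lt_top_iff_ne_top.2 D.tsum_eLqLpNorm_two_ne_top
  have h4 : (∫⁻ t in Ioo 0 T, D.H t ^ (2 : ℝ)) ^ (1 / (2 : ℝ)) < ⊤ :=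
    lt_of_le_of_lt h1 (ENNReal.add_lt_top.2 ⟨h2, h3⟩)
  exact (ENNReal.rpow_lt_top_iff_of_pos (by norm_num)).1 h4

/-- The majorant is finite at a.e. `t ∈ (0, T)`. [cite: CheskidovLuo2022, §2.6 (proof of Thm. 1.7)] -/
theorem ae_H_lt_top : ∀ᵐ t ∂(volume.restrict (Ioo 0 T)), D.H t < ⊤ := by
  have h := ae_lt_top' (D.aemeasurable_H.pow_const (2 : ℝ)) D.lintegral_H_sq_lt_top.ne
  filter_upwards [h] with t ht
  exact (ENNReal.rpow_lt_top_iff_of_pos two_pos).1 ht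

/-- **The limit is square integrable on `(0, T) × 𝕋^d`**: `∫₀ᵀ ∫ ‖u‖² ≤ ∫₀ᵀ H² < ∞`. [cite: CheskidovLuo2022, §2.6 (proof of Thm. 1.7)] -/
theorem lintegral_lintegral_enorm_lim_sq_lt_top :
    ∫⁻ t in Ioo 0 T, ∫⁻ x, ‖D.lim t x‖ₑ ^ 2 < ⊤ := by
  calc ∫⁻ t in Ioo 0 T, ∫⁻ x, ‖D.lim t x‖ₑ ^ 2
      = ∫⁻ t in Ioo 0 T, eLpNorm (D.lim t) 2 volume ^ (2 : ℝ) := by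
        refine setLIntegral_congr_fun measurableSet_Ioo fun t _ => ?_
        rw [lintegral_enorm_sq_eq_sq_eLpNorm_two, ENNReal.rpow_two]
    _ ≤ ∫⁻ t in Ioo 0 T, D.H t ^ (2 : ℝ) := setLIntegral_mono' measurableSet_Ioo fun t ht =>
        ENNReal.rpow_le_rpow (D.eLpNorm_lim_le_H (Ioo_subset_Icc_self ht)) zero_le_two
    _ < ⊤ := D.lintegral_H_sq_lt_top

omit [DecidableEq d] in
/-- `∫ ‖a‖² = (‖a‖²_{L²}).toReal` for a continuous field on the torus. [folklore] -/
theorem integral_norm_sq_eq_toReal {a : UnitAddTorus d → EuclideanSpace ℝ d} (ha : Continuous a) :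
    ∫ x, ‖a x‖ ^ 2 = (eLpNorm a 2 volume ^ 2).toReal := by
  rw [integral_eq_lintegral_of_nonneg_ae (ae_of_all _ fun x => sq_nonneg _)
    (ha.norm.pow 2).aestronglyMeasurable, ← lintegral_enorm_sq_eq_sq_eLpNorm_two]
  congr 1
  refine lintegral_congr fun x => ?_
  rw [ENNReal.ofReal_pow (norm_nonneg _), ofReal_norm]

/-! ## Measurability and divergence of the limit -/

/-- **The limit is a.e. strongly measurable on `(0, T) × ℝ^d`** (as the a.e. limit of the
continuous lifts of the `uₖ`, which are eventually constant off the null set `𝓢 × ℝ^d`). [cite: CheskidovLuo2022, §2.6 (proof of Thm. 1.7)] -/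
theorem aestronglyMeasurable_stLift_lim :
    AEStronglyMeasurable (FunctionSpaces.Torus.stLift D.lim)
      (volume.restrict (Ioo 0 T ×ˢ (univ : Set (EuclideanSpace ℝ d)))) := by
  refine aestronglyMeasurable_of_tendsto_ae atTop (fun k =>
    (D.nsr k).smooth_velocity.aestronglyMeasurable_stLift measurableSet_Ioo Ioo_subset_Icc_self) ?_
  have h1 : ∀ᵐ z ∂(volume.restrict (Ioo 0 T ×ˢ (univ : Set (EuclideanSpace ℝ d)))),
      z ∈ Ioo 0 T ×ˢ (univ : Set (EuclideanSpace ℝ d)) :=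
    ae_restrict_mem (measurableSet_Ioo.prod MeasurableSet.univ)
  have h2 : ∀ᵐ z ∂(volume.restrict (Ioo 0 T ×ˢ (univ : Set (EuclideanSpace ℝ d)))),
      z.1 ∉ D.residual := by
    refine ae_restrict_of_ae ?_
    have h0 : (volume : Measure (ℝ × EuclideanSpace ℝ d)) (Prod.fst ⁻¹' D.residual) = 0 := by
      rw [Measure.volume_eq_prod, ← prod_univ, Measure.prod_prod, D.volume_residual, zero_mul]
    exact measure_eq_zero_iff_ae_notMem.1 h0
  filter_upwards [h1, h2] with z hz hres
  obtain ⟨t, y⟩ := z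
  have ht : t ∈ Ioo 0 T := (mem_prod.1 hz).1
  simp only [FunctionSpaces.Torus.stLift_apply]
  have hev := D.eventually_U_eq_lim (Ioo_subset_Icc_self ht) hres
  exact (tendsto_const_nhds (x := D.lim t (FunctionSpaces.Torus.proj y))).congr'
    (hev.mono fun k hk => show D.lim t _ = D.U k t _ by rw [hk])

/-- The slices of the limit are weakly divergence free at every `t ∈ (0, T)`. [cite: CheskidovLuo2022, §2.6 (proof of Thm. 1.7)] -/
theorem ae_isWeaklyDivFree_lim :
    ∀ᵐ t ∂(volume.restrict (Ioo 0 T)), FunctionSpaces.Torus.IsWeaklyDivFree (D.lim t) :=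
  ae_restrict_of_forall_mem measurableSet_Ioo fun _ ht =>
    (D.isDivFree_lim (Ioo_subset_Icc_self ht)).isWeaklyDivFree_holds
      (D.isSmooth_lim (Ioo_subset_Icc_self ht))

end CheskidovLuoSequence

end Torus

end Literature.Analysis.FluidPDE
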